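import Summits.BirchSwinnertonDyer.BirchSwinnertonDyer.Theorems.ManinLocalTwoThreeNotTrivialEisensteinModThree
import Literature.NumberTheory.GaloisRepresentations.CyclotomicCharacterSurjectiveProofs
import HarnessLib

/-!
# Irreducible `W[3]`: the stabiliser of `μ_m` (`3 ∤ m`) in `Γ_ℚ` contains an element fixed-point-free on `W[3]`

Summit `BirchSwinnertonDyer`, route `ManinLocalTwoThree` (cell bsd-f2-manin), crux C3 `ManinPrimeToThreeAtNine`
(stmt-BirchSwinnertonDyer-22968).  Group-theoretic core of the proof of es's law **E-es-69♮**
`KatoCurve.NotTrivialEisensteinModThreeMultiplicative` ON THE IRREDUCIBLE LOCUS (sequel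
`ManinLocalTwoThreeNotTrivialEisensteinModThreeCyclotomic`: hNT₃(t) at every prime `t ≠ 3` when `W[3]` is irreducible).
Neither the Tate curve nor inertia groups are used:

* §1 residue facts over `𝔽₃` (`decide`): an invertible `2 × 2` matrix with eigenvalue `1` is `1`, a transvection (`A³ = 1 ≠ A`) or a
  reflection (`A² = 1`, `det A = −1`); the fixed vectors of a transvection / of a reflection form ONE line; `(A − 1)w` is fixed by `A`
  when `A³ = 1`.
* §2 **`exists_smul_ne_of_fixed_of_irreducible`** — if `W[3]` is irreducible and `3 ∤ m`, some `τ ∈ Γ_ℚ` fixing `μ_m` is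
  fixed-point-free on `W[3]`.  Otherwise every element of the image `N ◁ Γ` of the stabiliser `G₁` of `μ_m` is `1`, a transvection or a
  reflection (§1).  A transvection `u ∈ N`: for every conjugate `u' = g u g⁻¹ ∈ N` the product `u u' ∈ N` has a fixed vector, which forces
  `u'` to fix the centre of `u` (the vector `z = u'w − w` is fixed by both); so the centre is a `Γ_ℚ`-stable line — reducible
  (`false_of_stable_line`).  No transvection but a reflection `s ∈ N`: `s · g s g⁻¹ ∈ N` has determinant `1`, so it is `1`, `s` is
  central and its `+1`-eigenline is `Γ_ℚ`-stable — reducible.  `N = 1`: an automorphism fixing `μ_m` and inverting `μ₃`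
  (`RootOfUnityAction.exists_smul_eq_pow_and_smul_eq_self`, `3 ∤ m`) would act trivially on `W[3]`, hence fix the Weil-pairing cube
  root of unity (`exists_isPrimitiveRoot_fixed`) — absurd.

Axioms standard; no definitions; nothing about BSD, Manin's conjecture, C2/C3 or E-es-69 is proved.  References: J.-P. Serre, Invent.
Math. 15 (1972) §5.2; J. H. Silverman, *AEC* III.6.4, III.8.1.1; L. Washington, *Introduction to Cyclotomic Fields*, Thm. 2.5;
HOME/MEMO-es.md §32 (E-es-69♮).
-/

set_option autoImplicit false
set_option linter.dupNamespace false

noncomputable section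

open scoped Classical Matrix MatrixGroups ModularForm

open NumberField IsDedekindDomain Field WeierstrassCurve CongruenceSubgroup
  Literature.NumberTheory.EllipticCurves Literature.NumberTheory.EllipticCurves.ModularForms
  Literature.NumberTheory.GaloisRepresentations
  Summit.BirchSwinnertonDyer.Rank1Residual.ManinAdditive
  Summit.BirchSwinnertonDyer.Rank1Residual.ManinAdditive.KatoCurve

namespace Summit.BirchSwinnertonDyer.BirchSwinnertonDyer.Theorems.ManinLocalTwoThree

/-! ### §1  Residue facts over `𝔽₃` -/

section MatrixFacts

set_option synthInstance.maxHeartbeats 200000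
set_option synthInstance.maxSize 2000

/-- An invertible `2 × 2` matrix over `𝔽₃` with eigenvalue `1` is the identity, a transvection (`A³ = 1 ≠ A`) or a reflection
(`A² = 1`, `det A = −1`). [folklore] -/
theorem eq_one_or_transvection_or_reflection_of_mulVec_eq :
    ∀ (A : Matrix (Fin 2) (Fin 2) (ZMod 3)) (v : Fin 2 → ZMod 3), A.det ≠ 0 → v ≠ 0 → A *ᵥ v = v →
      A = 1 ∨ (A * A * A = 1 ∧ A ≠ 1) ∨ (A * A = 1 ∧ A.det = -1) := by
  decide +kernel

/-- The fixed vectors of a transvection of `𝔽₃²` form one line. [folklore] -/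
theorem transvection_fixed_line :
    ∀ (A : Matrix (Fin 2) (Fin 2) (ZMod 3)) (v w : Fin 2 → ZMod 3), A * A * A = 1 → A ≠ 1 → v ≠ 0 →
      A *ᵥ v = v → A *ᵥ w = w → (w = 0 ∨ w = v ∨ w = 2 • v) := by
  decide +kernel

/-- For `A³ = 1` over `𝔽₃`, `(A − 1)w` is fixed by `A`. [folklore] -/
theorem transvection_mulVec_sub_fixed :
    ∀ (A : Matrix (Fin 2) (Fin 2) (ZMod 3)) (w : Fin 2 → ZMod 3), A * A * A = 1 →
      A *ᵥ (A *ᵥ w - w) = A *ᵥ w - w := by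
  decide +kernel

/-- The `+1`-eigenvectors of a reflection of `𝔽₃²` form one line. [folklore] -/
theorem reflection_fixed_line :
    ∀ (A : Matrix (Fin 2) (Fin 2) (ZMod 3)) (v w : Fin 2 → ZMod 3), A * A = 1 → A.det = -1 → v ≠ 0 →
      A *ᵥ v = v → A *ᵥ w = w → (w = 0 ∨ w = v ∨ w = 2 • v) := by
  decide +kernel

/-- `B(2v) = 2v ⟹ Bv = v` over `𝔽₃`. [folklore] -/
theorem mulVec_eq_of_mulVec_two_smul :
    ∀ (B : Matrix (Fin 2) (Fin 2) (ZMod 3)) (v : Fin 2 → ZMod 3), B *ᵥ (2 • v) = 2 • v → B *ᵥ v = v := by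
  decide +kernel

end MatrixFacts

/-! ### §2  Irreducible `W[3]`: the stabiliser of `μ_m` (`3 ∤ m`) contains a fixed-point-free element -/

section Core

variable (W : WeierstrassCurve ℚ) [W.IsElliptic]

/-- A `Γ_ℚ`-stable line in `W[3]` (read in a frame) contradicts irreducibility of `W[3]`. [cite: Serre1972, §5.2 (iii)] -/
private theorem false_of_stable_line (hirr : W.HasIrreducibleModPGaloisRep 3)
    (e : W.geomTorsion ((3 : ℕ) : ℤ) ≃+ (Fin 2 → ZMod 3))
    (A : absoluteGaloisGroup ℚ → Matrix (Fin 2) (Fin 2) (ZMod 3))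
    (hAe : ∀ (σ : absoluteGaloisGroup ℚ) (P : W.geomTorsion ((3 : ℕ) : ℤ)), e (σ • P) = A σ *ᵥ e P)
    {v₀ : Fin 2 → ZMod 3} (hv₀ : v₀ ≠ 0)
    (hstab : ∀ σ : absoluteGaloisGroup ℚ, A σ *ᵥ v₀ = v₀ ∨ A σ *ᵥ v₀ = 2 • v₀) : False := by
  classical
  set P₀ : W.geomTorsion ((3 : ℕ) : ℤ) := e.symm v₀ with hP₀def
  have heP₀ : e P₀ = v₀ := e.apply_symm_apply v₀
  have hP₀ : P₀ ≠ 0 := fun h ↦ hv₀ (by rw [← heP₀, h, map_zero])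
  have hσP₀ : ∀ σ : absoluteGaloisGroup ℚ, σ • P₀ = P₀ ∨ σ • P₀ = 2 • P₀ := by
    intro σ
    rcases hstab σ with h | h
    · left
      exact e.injective (by rw [hAe, heP₀, h])
    · right
      exact e.injective (by rw [hAe, heP₀, h, map_nsmul, heP₀])
  set H : AddSubgroup (W.geomTorsion ((3 : ℕ) : ℤ)) := AddSubgroup.zmultiples P₀ with hHdef
  have hHstab : ∀ σ : absoluteGaloisGroup ℚ, ∀ Q ∈ H, σ • Q ∈ H := by
    intro σ Q hQ
    obtain ⟨k, rfl⟩ := AddSubgroup.mem_zmultiples_iff.mp hQ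
    rw [smul_comm σ k P₀]
    rcases hσP₀ σ with h | h
    · rw [h]; exact AddSubgroup.zsmul_mem _ (AddSubgroup.mem_zmultiples P₀) k
    · rw [h]; exact AddSubgroup.zsmul_mem _ (AddSubgroup.nsmul_mem _ (AddSubgroup.mem_zmultiples P₀) 2) k
  rcases hirr H hHstab with hbot | htop
  · exact hP₀ (by
      have hmem : P₀ ∈ H := AddSubgroup.mem_zmultiples P₀
      rw [hbot] at hmem
      exact (AddSubgroup.mem_bot).mp hmem)
  · -- `#H = ord P₀ ∣ 3` but `#W[3] = 9`
    have h3P₀ : (3 : ℕ) • P₀ = 0 := by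
      apply Subtype.ext
      rw [AddSubmonoidClass.coe_nsmul, ZeroMemClass.coe_zero, ← natCast_zsmul]
      simpa only [AddSubgroup.torsionBy, Submodule.mem_toAddSubgroup, Submodule.mem_torsionBy_iff] using P₀.2
    have hord : addOrderOf P₀ ∣ 3 := addOrderOf_dvd_of_nsmul_eq_zero h3P₀
    have hcardH : Nat.card H = addOrderOf P₀ := Nat.card_zmultiples P₀
    have hcard9 : Nat.card (W.geomTorsion ((3 : ℕ) : ℤ)) = 3 ^ 2 :=
      card_torsionPoints_eq_sq_holds W (AlgebraicClosure ℚ) (n := 3) (by norm_num)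
    have htop' : Nat.card H = Nat.card (W.geomTorsion ((3 : ℕ) : ℤ)) := by
      rw [htop]; exact AddSubgroup.card_top
    rw [hcardH, hcard9] at htop'
    have := Nat.le_of_dvd (by norm_num) hord
    omega

/-- **If `W[3]` is irreducible and `3 ∤ m`, some `τ ∈ Γ_ℚ` fixing the `m`-th roots of unity is fixed-point-free on `W[3]`.**
See the module docstring, §3: the image `N` of the stabiliser of `μ_m` is normal; were it free of fixed-point-free elements, a
transvection in `N` would have a `Γ_ℚ`-stable centre, a reflection in `N` (absent transvections) would be central with a `Γ_ℚ`-stable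
eigenline, and `N = 1` is excluded by an automorphism fixing `μ_m` and inverting `μ₃ ⊂ ℚ(W[3])` (Weil pairing).
[cite: Serre1972, §5.2 (iii)–(iv)] [cite: SilvermanAEC2009, Cor. III.8.1.1] -/
theorem exists_smul_ne_of_fixed_of_irreducible (hirr : W.HasIrreducibleModPGaloisRep 3) {m : ℕ} [NeZero m]
    (hm : Nat.Coprime 3 m) :
    ∃ τ : absoluteGaloisGroup ℚ, (∀ ζ : AlgebraicClosure ℚ, ζ ^ m = 1 → τ • ζ = ζ) ∧
      ∀ P : W.geomTorsion ((3 : ℕ) : ℤ), P ≠ 0 → τ • P ≠ P := by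
  classical
  haveI : Fact (Nat.Prime 3) := ⟨Nat.prime_three⟩
  by_contra hcon
  push Not at hcon
  -- the stabiliser of `μ_m`: closed under products and conjugation
  have hFmul : ∀ σ τ : absoluteGaloisGroup ℚ, (∀ ζ : AlgebraicClosure ℚ, ζ ^ m = 1 → σ • ζ = ζ) →
      (∀ ζ : AlgebraicClosure ℚ, ζ ^ m = 1 → τ • ζ = ζ) →
      ∀ ζ : AlgebraicClosure ℚ, ζ ^ m = 1 → (σ * τ) • ζ = ζ :=
    fun σ τ hσ hτ ζ hζ ↦ by rw [mul_smul, hτ ζ hζ, hσ ζ hζ]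
  have hFconj : ∀ g σ : absoluteGaloisGroup ℚ, (∀ ζ : AlgebraicClosure ℚ, ζ ^ m = 1 → σ • ζ = ζ) →
      ∀ ζ : AlgebraicClosure ℚ, ζ ^ m = 1 → (g * σ * g⁻¹) • ζ = ζ := by
    intro g σ hσ ζ hζ
    have h1 : (g⁻¹ • ζ) ^ m = 1 := by rw [← smul_pow', hζ, smul_one]
    rw [mul_smul, mul_smul, hσ _ h1, smul_inv_smul]
  -- a frame `W[3] ≅ 𝔽₃²`
  obtain ⟨e, Φ, hframe, -, -, -⟩ := exists_frame_galoisRepTorsion_rat W 3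
  set ρ : absoluteGaloisGroup ℚ →* GL (Fin 2) (ZMod 3) :=
    Φ.toMonoidHom.comp (galoisRepTorsion W ((3 : ℕ) : ℤ)) with hρdef
  set A : absoluteGaloisGroup ℚ → Matrix (Fin 2) (Fin 2) (ZMod 3) :=
    fun σ ↦ ((ρ σ : GL (Fin 2) (ZMod 3)) : Matrix (Fin 2) (Fin 2) (ZMod 3)) with hAdef
  have hAe : ∀ (σ : absoluteGaloisGroup ℚ) (P : W.geomTorsion ((3 : ℕ) : ℤ)), e (σ • P) = A σ *ᵥ e P := by
    intro σ P
    have h := hframe (galoisRepTorsion W ((3 : ℕ) : ℤ) σ) P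
    rwa [galoisRepTorsion_apply] at h
  have hAmul : ∀ σ τ : absoluteGaloisGroup ℚ, A (σ * τ) = A σ * A τ := fun σ τ ↦ by
    simp only [hAdef, map_mul, Units.val_mul]
  have hAinv : ∀ σ : absoluteGaloisGroup ℚ, A σ⁻¹ * A σ = 1 := fun σ ↦ by
    rw [← hAmul, inv_mul_cancel]; simp only [hAdef, map_one, Units.val_one]
  have hAinv' : ∀ σ : absoluteGaloisGroup ℚ, A σ * A σ⁻¹ = 1 := fun σ ↦ by
    rw [← hAmul, mul_inv_cancel]; simp only [hAdef, map_one, Units.val_one]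
  have hAdet : ∀ σ : absoluteGaloisGroup ℚ, (A σ).det ≠ 0 := fun σ ↦ by
    rw [hAdef, ← Matrix.GeneralLinearGroup.val_det_apply]
    exact Units.ne_zero _
  have hAne : ∀ (σ : absoluteGaloisGroup ℚ) (v : Fin 2 → ZMod 3), v ≠ 0 → A σ *ᵥ v ≠ 0 := by
    intro σ v hv h
    apply hv
    have := congrArg (fun x ↦ A σ⁻¹ *ᵥ x) h
    simpa only [Matrix.mulVec_mulVec, hAinv, Matrix.one_mulVec, Matrix.mulVec_zero] using this
  -- every element of the stabiliser has a fixed vector (the absurd hypothesis)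
  have hfixv : ∀ σ : absoluteGaloisGroup ℚ, (∀ ζ : AlgebraicClosure ℚ, ζ ^ m = 1 → σ • ζ = ζ) →
      ∃ v : Fin 2 → ZMod 3, v ≠ 0 ∧ A σ *ᵥ v = v := by
    intro σ hσ
    obtain ⟨P, hP0, hP⟩ := hcon σ hσ
    exact ⟨e P, fun h ↦ hP0 (e.injective (by rw [h, map_zero])), by rw [← hAe, hP]⟩
  by_cases hA : ∃ σ₀ : absoluteGaloisGroup ℚ, (∀ ζ : AlgebraicClosure ℚ, ζ ^ m = 1 → σ₀ • ζ = ζ) ∧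
      A σ₀ * A σ₀ * A σ₀ = 1 ∧ A σ₀ ≠ 1
  · -- (A) a transvection `u` in `N`: its centre is `Γ_ℚ`-stable
    obtain ⟨σ₀, hσ₀, hu3, hu1⟩ := hA
    obtain ⟨v₀, hv₀, huv₀⟩ := hfixv σ₀ hσ₀
    refine false_of_stable_line W hirr e A hAe hv₀ fun g ↦ ?_
    -- the conjugate `u' = A(g⁻¹ σ₀ g)` and the product `u u' ∈ N`
    have hσ' := hFconj g⁻¹ σ₀ hσ₀
    rw [inv_inv] at hσ'
    obtain ⟨w, hw0, hw⟩ := hfixv _ (hFmul _ _ hσ₀ hσ')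
    have hu'3 : A (g⁻¹ * σ₀ * g) * A (g⁻¹ * σ₀ * g) * A (g⁻¹ * σ₀ * g) = 1 := by
      rw [← hAmul, ← hAmul, show g⁻¹ * σ₀ * g * (g⁻¹ * σ₀ * g) * (g⁻¹ * σ₀ * g) =
        g⁻¹ * (σ₀ * σ₀ * σ₀) * g by group, hAmul, hAmul, hAmul, hAmul, hu3, mul_one, hAinv]
    rw [hAmul, ← Matrix.mulVec_mulVec] at hw
    -- `u' w = u² w`
    have hu'w : A (g⁻¹ * σ₀ * g) *ᵥ w = (A σ₀ * A σ₀) *ᵥ w := by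
      have := congrArg (fun x ↦ (A σ₀ * A σ₀) *ᵥ x) hw
      simp only [Matrix.mulVec_mulVec] at this
      rw [← mul_assoc, hu3, one_mul] at this
      exact this
    -- `z = u' w - w` is fixed by `u'` and by `u`
    set z := A (g⁻¹ * σ₀ * g) *ᵥ w - w with hzdef
    have hz1 : A (g⁻¹ * σ₀ * g) *ᵥ z = z := transvection_mulVec_sub_fixed _ w hu'3
    have hu6 : A σ₀ * A σ₀ * (A σ₀ * A σ₀) * (A σ₀ * A σ₀) = 1 := by
      rw [show A σ₀ * A σ₀ * (A σ₀ * A σ₀) * (A σ₀ * A σ₀) = (A σ₀ * A σ₀ * A σ₀) * (A σ₀ * A σ₀ * A σ₀) by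
        noncomm_ring, hu3, one_mul]
    have hz2' : (A σ₀ * A σ₀) *ᵥ z = z := by
      rw [hzdef, hu'w]; exact transvection_mulVec_sub_fixed _ w hu6
    have hz2 : A σ₀ *ᵥ z = z := by
      have := congrArg (fun x ↦ A σ₀ *ᵥ x) hz2'
      simp only [Matrix.mulVec_mulVec] at this
      rw [show A σ₀ * (A σ₀ * A σ₀) = A σ₀ * A σ₀ * A σ₀ from (mul_assoc _ _ _).symm, hu3,
        Matrix.one_mulVec] at this
      exact this.symm
    -- a non-zero common fixed vector `x` of `u` and `u'`
    obtain ⟨x, hx0, hux, hu'x⟩ : ∃ x : Fin 2 → ZMod 3, x ≠ 0 ∧ A σ₀ *ᵥ x = x ∧ A (g⁻¹ * σ₀ * g) *ᵥ x = x := by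
      by_cases hz : z = 0
      · have hu'w' : A (g⁻¹ * σ₀ * g) *ᵥ w = w := sub_eq_zero.mp (by rw [← hzdef, hz])
        refine ⟨w, hw0, ?_, hu'w'⟩
        rw [hu'w', eq_comm] at hu'w
        have := congrArg (fun x ↦ A σ₀ *ᵥ x) hu'w
        simp only [Matrix.mulVec_mulVec] at this
        rwa [show A σ₀ * (A σ₀ * A σ₀) = A σ₀ * A σ₀ * A σ₀ from (mul_assoc _ _ _).symm, hu3,
          Matrix.one_mulVec, eq_comm] at this
      · exact ⟨z, hz, hz2, hz1⟩
    -- so `u'` fixes the centre `v₀` of `u`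
    have hu'v₀ : A (g⁻¹ * σ₀ * g) *ᵥ v₀ = v₀ := by
      rcases transvection_fixed_line (A σ₀) v₀ x hu3 hu1 hv₀ huv₀ hux with h | h | h
      · exact (hx0 h).elim
      · rwa [h] at hu'x
      · rw [h] at hu'x; exact mulVec_eq_of_mulVec_two_smul _ v₀ hu'x
    -- hence `u` fixes `A g v₀`, which lies on the centre
    have hfix : A σ₀ *ᵥ (A g *ᵥ v₀) = A g *ᵥ v₀ := by
      have := congrArg (fun x ↦ A g *ᵥ x) hu'v₀
      simp only [Matrix.mulVec_mulVec] at this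
      rwa [hAmul, hAmul, ← mul_assoc, ← mul_assoc, hAinv', one_mul, ← Matrix.mulVec_mulVec] at this
    rcases transvection_fixed_line (A σ₀) v₀ (A g *ᵥ v₀) hu3 hu1 hv₀ huv₀ hfix with h | h | h
    · exact (hAne g v₀ hv₀ h).elim
    · exact Or.inl h
    · exact Or.inr h
  · push Not at hA
    by_cases hB : ∃ σ₁ : absoluteGaloisGroup ℚ, (∀ ζ : AlgebraicClosure ℚ, ζ ^ m = 1 → σ₁ • ζ = ζ) ∧ A σ₁ ≠ 1
    · -- (B) no transvection, a reflection `s` in `N`: `s` is central, its `+1`-eigenline is `Γ_ℚ`-stable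
      obtain ⟨σ₁, hσ₁, hs1⟩ := hB
      obtain ⟨v₁, hv₁, hsv₁⟩ := hfixv σ₁ hσ₁
      rcases eq_one_or_transvection_or_reflection_of_mulVec_eq (A σ₁) v₁ (hAdet σ₁) hv₁ hsv₁ with
        h1 | ⟨h3, -⟩ | ⟨hs2, hsdet⟩
      · exact hs1 h1
      · exact hs1 (hA σ₁ hσ₁ h3)
      · refine false_of_stable_line W hirr e A hAe hv₁ fun g ↦ ?_
        -- `s s' = 1` for the conjugate `s' = A(g σ₁ g⁻¹)`
        have hσ' := hFconj g σ₁ hσ₁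
        obtain ⟨w, hw0, hw⟩ := hfixv _ (hFmul _ _ hσ₁ hσ')
        have hss' : A σ₁ * A (g * σ₁ * g⁻¹) = 1 := by
          rcases eq_one_or_transvection_or_reflection_of_mulVec_eq (A (σ₁ * (g * σ₁ * g⁻¹))) w (hAdet _) hw0 hw
            with h1 | ⟨h3, -⟩ | ⟨-, hdet'⟩
          · rwa [hAmul] at h1
          · have := hA _ (hFmul _ _ hσ₁ hσ') h3; rwa [hAmul] at this
          · exfalso
            rw [hAmul, hAmul, hAmul, Matrix.det_mul, Matrix.det_mul, Matrix.det_mul, hsdet,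
              mul_comm (A g).det, mul_assoc, ← Matrix.det_mul, hAinv', Matrix.det_one, mul_one] at hdet'
            revert hdet'; decide
        have hs' : A (g * σ₁ * g⁻¹) = A σ₁ := by
          have := congrArg (fun x ↦ A σ₁ * x) hss'
          simp only [← mul_assoc, hs2, one_mul, mul_one] at this
          exact this
        have hcomm : A g * A σ₁ = A σ₁ * A g := by
          have := congrArg (fun x ↦ x * A g) hs'
          simp only [hAmul, mul_assoc, hAinv, mul_one] at this
          exact this
        have hfix : A σ₁ *ᵥ (A g *ᵥ v₁) = A g *ᵥ v₁ := by
          rw [Matrix.mulVec_mulVec, ← hcomm, ← Matrix.mulVec_mulVec, hsv₁]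
        rcases reflection_fixed_line (A σ₁) v₁ (A g *ᵥ v₁) hs2 hsdet hv₁ hsv₁ hfix with h | h | h
        · exact (hAne g v₁ hv₁ h).elim
        · exact Or.inl h
        · exact Or.inr h
    · -- (C) the stabiliser acts trivially on `W[3]`: impossible, as `μ₃ ⊂ ℚ(W[3])` and `3 ∤ m`
      push Not at hB
      haveI : NeZero (3 : ℕ) := ⟨by norm_num⟩
      have hirr3m : Irreducible (Polynomial.cyclotomic (3 * m) ℚ) :=
        Polynomial.cyclotomic.irreducible_rat (Nat.mul_pos (by norm_num) (Nat.pos_of_ne_zero (NeZero.ne m)))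
      obtain ⟨σ, hσ3, hσm⟩ := RootOfUnityAction.exists_smul_eq_pow_and_smul_eq_self (K := ℚ) hm hirr3m (-1)
      have hσ1 : A σ = 1 := hB σ hσm
      have htriv : ∀ T : W.geomTorsion ((3 : ℕ) : ℤ), σ • T = T := fun T ↦
        e.injective (by rw [hAe, hσ1, Matrix.one_mulVec])
      have hT₀ : ∃ T₀ : W.geomPoints, ((3 : ℕ) : ℤ) • T₀ = 0 ∧ ∀ d : ℕ, 0 < d → d < 3 → (d : ℤ) • T₀ ≠ 0 := by
        have h := exists_geomTorsion_exactOrder_prime W Nat.prime_three 0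
        simpa only [zero_add, pow_one] using h
      obtain ⟨ζ, hζ, hζfix⟩ := exists_isPrimitiveRoot_fixed (E := W) (q := 3) (by norm_num) hT₀
      have h1 : σ • ζ = ζ := hζfix σ htriv
      have h2 := hσ3 ζ hζ.pow_eq_one
      have hval : (-1 : ZMod 3).val = 2 := rfl
      rw [Units.val_neg, Units.val_one, hval, h1] at h2
      have hne : ζ ≠ 0 := hζ.ne_zero (by norm_num)
      have hζ1 : ζ = 1 := by
        have : ζ * ζ = ζ * 1 := by rw [mul_one, ← pow_two, ← h2]
        exact mul_left_cancel₀ hne this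
      exact hζ.ne_one (by norm_num) hζ1

end Core

end Summit.BirchSwinnertonDyer.BirchSwinnertonDyer.Theorems.ManinLocalTwoThree

end
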